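import Literature.MathematicalPhysics.QuantumFieldTheory.Balaban1983to89.B14Thm2
import Literature.MathematicalPhysics.QuantumFieldTheory.Balaban1983to89.Node00.Record13CoPH

/-!
# DAG node N11 — DEFINITIONS: [III] Theorem 2's CARRIER AT NODE 00's STAGE-13 OBJECTS — the general-Ω sums of (2.43)∕(2.44) on r11's tower of record (`EjSubOn`, `RjSubOn`),
# the level data a (2.43)∕(2.44) instance reads (`LevelDatum θ p k`: history, witness, configuration, region Ω, weight φ), and `sect2DataOfRecord₁₃ θ p : B14.Sect2Data` — so that
# `B14.Thm2Printed` ∕ `B14Thm2.Ineq243` ∕ `Ineq244` (the cell's VERBATIM typings of Thm 2 p. 263) are stated AT THE ₁₃ OBJECTS BY NAME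

HEADER — WORK-UNIT METADATA.  Cell `pub-ymgap`, YM-PLAN Track A (HUMAN RULING D-0062 ∕ D-0149), seat `pub-ymgap-dag-n11-w2` (g0; WIDTH SEAT 2 on node n11 [B14]), route
`BalabanUVNodes`, key item K1⁷ `StabilityBAtRecordR13SepCoPH` = stmt-QuantumFields-20542; DEFINITION lane (`--kind definition --supports 20542 --as helper`), count-neutral.
[III] = [Balaban1988Convergent].  Over r11's `B14.Eq225Concrete` ((2.23)–(2.25) with body: `EjSub`, `smearedWilson`), 11b∕11c∕def-T v1.7 (`Node00.Sect2FrameOfRecord`: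
`Sect2.TermValues`, `sect2TowerOfRecord`, `Sect2.admE`, `Sect2.domSys ∕ domSites`; `Node00.Record13CoPH`: `Stage13HParams`, `rzAt`, `Phih`, `settingOfRecord₁₃`, `SLaw₁₃CoPH`),
`B15DeterminingSets.gammaRegion` ((2.2) `Γ_n`), and the cell's `B14.Sect2Data` ∕ `B14.Thm2Printed` (B14.lean :223 ∕ :270).

WHY THIS FILE.  This seat's proof files (`…Thm2Ineq249AtRecord13CoPH` p583777 and successors) read Theorem 2's sentences at the SPECIAL data print itself uses on p. 263 («taking
Ω = Bʲ(Λ_j⁰), φ = φ_j in (2.43)»; «taking Ω = Bʲ(Λ_j⁰) in (2.44)») — the (2.25)∕(2.30) summands of r11's `action23`.  The cell's VERBATIM typing of Theorem 2 is `B14.Thm2Printed H033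
fam L β κ₀` over the abstract carrier `B14.Sect2Data` (index type `Ω` of «the remaining data (j, k, Ω, {Ω_j}, {Λ_j}, T, φ, U_k)», left-hand sides `eTerm ∕ rTerm`, volumes `gammaVol n ω =
|Γ_n ∩ Ω|`).  To state THAT sentence at the ₁₃ objects by name one needs the GENERAL-Ω left-hand sides on the tower of record — the z-sum of (2.43) restricted to `Λ_j⁰ ∩ Ω` and the
X-sum of (2.44) over `X ⊂ Λ_j, X ∩ Ω ≠ ∅` — and a carrier instance whose index ranges over every level's history ∕ witness ∕ configuration ∕ region ∕ weight.  This file DEFINES them;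
the successor proof file derives this seat's per-scale binders (`h243`) from `B14Thm2.Ineq243 (sect2DataOfRecord₁₃ θ p) …` at `Ω = T_η`, `φ = φ_j`, and records what `Ineq244` says there.

WHAT THIS FILE DEFINES ∕ PROVES (4 `def`s (2 functions, 1 structure, 1 carrier instance) + `rfl`∕bookkeeping faces; 0 `sorry`, standard axioms; no `instance`, no `notation`).
§1 generic over any `Step.LFTower` with r11's (2.26)–(2.27) range predicate: `EjSubOn T admE j Ωz U` (the z-sum of (2.43) restricted to a point set `Ωz`), `RjSubOn T admΩ j U` (the
   X-sum of (2.44) over a domain range `admΩ`); faces `EjSubOn_of_forall_true` ∕ `EjSubOn_true` (`Ωz ≡ true` gives r11's `EjSub`), `RjSubOn_congr`.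
§2 at the ₁₃ objects: `LevelDatum θ p k` (history `s`, witness `t`, configuration `U`, region `Ω ⊂ T_η`, plaquette weight `φ`); `sect2DataOfRecord₁₃ θ p : B14.Sect2Data` with `K := p.K`,
   `flow := flowOfRun (gOfRecord₁₃ …)`, `InductiveAssumption k := SLaw₁₃CoPH F N θ p k` (the §2 form of `ρ_k` of record = Theorem 1's conclusion at level `k`), `Ω := Σ k, LevelDatum θ p k`,
   `eTerm j k ⟨k′, d⟩ :=` the left-hand side of (2.43) at `d` when `k′ = k` (else `0`: no level-`k` term is read off level-`k′` data), `rTerm` likewise with print's (2.44) range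
   `X ⊂ Λ_j(s), X ∩ Ω ≠ ∅`, `gammaVol n ⟨k′, d⟩ := |Γ_n(s) ∩ Ω|` counted in `T₁^{(n)}`-points ((2.2) `gammaRegion`, p. 263 «the number of points in Γ_n∩Ω ⊂ T₁^{(n)}»); faces
   `sect2DataOfRecord₁₃_K ∕ _flow ∕ _inductiveAssumption` (`rfl`), `eTerm_mk_self ∕ rTerm_mk_self` (at level-`k` data the `if` is gone), `eTerm_mk_of_ne ∕ rTerm_mk_of_ne`,
   `eTerm_at_univ_phi` (at `Ω = T_η`, `φ = φ_j(s)`: `eTerm j k ⟨k, d⟩ = EjSub(…of record…) j U − β_j(g_{j−1})·A(φ_j, U)` — this seat's `h243` left-hand side, `B14.Eq225Concrete.EjSub`).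

HONEST SCOPE.  Definitions of record + bookkeeping; NOTHING of Bałaban asserted (Theorem 2 is a `def … : Prop` of the cell, consumed as a hypothesis by the successor).  LOCATED (cell
GAPS G-pv01-1 (ii), restated at the objects): print's (2.44) range «X ⊂ Λ_j, X ∩ Ω ≠ ∅» (`rTerm`) is NOT the (2.30) range «X ⊂ Λ_j^{∼−1}» of `action23`'s 𝐑-summand at any Ω — the
identification «taking Ω = Bʲ(Λ_j⁰) in (2.44)» is the reader's; this seat's 𝐑-side binder `h244` is therefore served per DOMAIN (`…Thm2RSideAtRecord13CoPH`, p. 283's sentence), not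
from `Ineq244`.  N11 NOT discharged; K1⁷ NOT closed; counts unmoved (typed 28∕28 · discharged 5∕27).  One finite four-torus programme at fixed `ε = L^{−K}`; R4 closes only the
conditional finite-𝕋⁴ rung `BalabanLadder.UV`; NOT ℝ⁴, NOT OS, NOT a mass gap, NOT Clay.  Sources: [III] Thm 2 (2.43)–(2.44) p. 263, (2.2) p. 255, (2.25)–(2.27) p. 259, (2.30) p. 260.
-/

noncomputable section

open scoped BigOperators Matrix.Norms.L2Operator

namespace Summit.QuantumFields.YangMills.Theorems.BalabanUVNodesN11Thm2Sect2DataOfRecordDefs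

open Literature.MathematicalPhysics.QuantumFieldTheory.Balaban1983to89 Step B14.Eq225Concrete B14.LocalCoupling Finset
open T4Continuum Node00 B15DeterminingSets

/-! ## §1. The general-Ω left-hand sides of (2.43) ∕ (2.44) on a tower -/

section Generic

variable {P : Params} {G : Type*} [GaugeGroup G] {Φ 𝒢 𝔄 : Type*}
variable (T : LFTower P G Φ 𝒢 𝔄) (admE : (j : ℕ) → (T.sys j).Dom → T.Pt j → Bool)

/-- **The z-sum of (2.43) restricted to a point set** `Ωz` (print: `Σ_{z ∈ Λ_j⁰ ∩ Ω} [𝐄^{(j)}(Λ_j,U_k,z) − 𝐄^{(j)}(Λ_j,1,z)]`, with (2.26) `𝐄^{(j)}(Λ_j,U,z) = Σ_{X∋z, X⊂Λ_j} 𝐄^{(j)}(X,U,z)`): r11's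
`EjSub` with the extra indicator `Ωz z`. [cite: Balaban1988Convergent, (2.43) p.263, (2.26)–(2.27) p.259] -/
def EjSubOn (j : ℕ) (Ωz : T.Pt j → Bool) (U : GaugeField P 0 G) : ℝ :=
  ∑ X : (T.sys j).Dom, ∑ z : T.Pt j,
    if admE j X z = true ∧ Ωz z = true then ((T.E j X z (T.flow.g (j - 1)) (T.ofBackground U)).re - (T.E j X z (T.flow.g (j - 1)) (T.ofBackground 1)).re) else 0

/-- **The X-sum of (2.44) over a domain range** `admΩ` (print: `Σ_{X∈𝐃_j, X⊂Λ_j, X∩Ω≠∅} [𝐑^{(j)}(X,U_k) − 𝐑^{(j)}(X,1)]`). [cite: Balaban1988Convergent, (2.44) p.263] -/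
def RjSubOn (j : ℕ) (admΩ : (T.sys j).Dom → Bool) (U : GaugeField P 0 G) : ℝ :=
  ∑ X : (T.sys j).Dom, if admΩ X = true then ((T.R j X (T.ofBackground U)).re - (T.R j X (T.ofBackground 1)).re) else 0

/-- On a point set containing every point (`Ωz z = true` for all `z`: `Ω ⊇ Λ_j⁰`, e.g. `Ω = T_η` or print's `Ω = Bʲ(Λ_j⁰)`) the restricted z-sum IS r11's (2.25) summand `EjSub`.
[cite: Balaban1988Convergent, (2.25)–(2.26) p.259, (2.43) p.263] -/
theorem EjSubOn_of_forall_true (j : ℕ) (Ωz : T.Pt j → Bool) (U : GaugeField P 0 G) (hΩ : ∀ z, Ωz z = true) :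
    EjSubOn T admE j Ωz U = EjSub T admE j U := by
  unfold EjSubOn EjSub
  refine Finset.sum_congr rfl fun X _ => Finset.sum_congr rfl fun z _ => ?_
  by_cases h : admE j X z = true
  · simp [h, hΩ z]
  · simp [h]

/-- At `Ωz ≡ true` the restricted z-sum IS `EjSub`. [cite: Balaban1988Convergent, (2.25)–(2.26) p.259, (2.43) p.263] -/
theorem EjSubOn_true (j : ℕ) (U : GaugeField P 0 G) : EjSubOn T admE j (fun _ => true) U = EjSub T admE j U :=
  EjSubOn_of_forall_true T admE j _ U fun _ => rfl

/-- `RjSubOn` depends on the range only through its values. [cite: Balaban1988Convergent, (2.44) p.263 (bookkeeping)] -/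
theorem RjSubOn_congr (j : ℕ) {adm adm' : (T.sys j).Dom → Bool} (h : ∀ X, adm X = adm' X) (U : GaugeField P 0 G) :
    RjSubOn T j adm U = RjSubOn T j adm' U := by
  unfold RjSubOn
  exact Finset.sum_congr rfl fun X _ => by rw [h X]

end Generic

/-! ## §2. At the ₁₃ objects: the level data, and `B14.Sect2Data` OF RECORD -/

section AtRecord13

variable {F : T4Family} {N : ℕ} [NeZero N]

/-- **THE DATA A (2.43)∕(2.44) INSTANCE READS AT LEVEL `k`** of the run `p` («the remaining data (j, k, Ω, {Ω_j}, {Λ_j}, T, φ, U_k)» of `B14.Sect2Data.Ω`, at NODE 00's objects): the (2.18)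
history `s` (its `{Ω_j}, {Λ_j}`), the exposed §2 witness `t` (its 𝐄 ∕ 𝐑 ∕ 𝐁 values), the configuration `U` (= `U_k(V)`, «sufficiently regular»), the region `Ω ⊂ T_η` (fine sites) and the
plaquette weight `φ` of `A(φ, U_k)`. [cite: Balaban1988Convergent, Thm 2 p.263, (2.18) p.257] -/
structure LevelDatum (θ : Stage13HParams F N) (p : B12.RunParams) (k : ℕ) where
  /-- the (2.18) history `{Ω_j}, {Λ_j}` of length `k` -/
  s : SeqOfRecord F θ.ν θ.τ9.M (gOfRecord₁₃ F N θ.toStage13Params p) p.K k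
  /-- the exposed §2 witness (term values) -/
  t : Sect2.TermValues (F.P p.K) (MatA N) (FluctV N) θ.τ9.M
  /-- the configuration `U_k` read in `T_η` -/
  U : GaugeField (F.P p.K) 0 (SU N)
  /-- the region `Ω` of (2.43)∕(2.44), as fine sites -/
  region : Set (Site (F.P p.K) 0)
  /-- the plaquette weight `φ` of `A(φ, U_k)` in (2.43) -/
  weight : Plaq (F.P p.K) 0 → ℝ

variable (θ : Stage13HParams F N) (p : B12.RunParams)

open Classical in
/-- **`B14.Sect2Data` OF RECORD** for the run `p` at the Stage-13 parameter `θ` (v1.7 `CoPH`): `K := p.K`; `flow := flowOfRun (gOfRecord₁₃ …)` ((0.20) by `ring`); `InductiveAssumption k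
:= SLaw₁₃CoPH F N θ p k` (Theorem 1's conclusion at level `k` = the §2 form of `ρ_k` of record); `Ω := Σ k, LevelDatum θ p k`; `eTerm j k ⟨k′, d⟩` := the left-hand side of (2.43) read at
`d` — `EjSubOn` on the tower of record of `(d.s, d.t)` with the (2.26)–(2.27) range of `d.s`, restricted to `{z : z ∈ Ω}`, minus `β_j(g_{j−1})·A(φ, U)` — WHEN `k′ = k`, and `0` otherwise
(no level-`k` term is read off level-`k′` data); `rTerm j k ⟨k′, d⟩` := print's (2.44) sum `Σ_{X∈𝐃_j, X⊂Λ_j(s), X∩Ω≠∅} Re[𝐑^{(j)}(X,(ιU,0)) − 𝐑^{(j)}(X,(ι1,0))]` when `k′ = k`, else `0`;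
`gammaVol n ⟨k′, d⟩ := |Γ_n(s) ∩ Ω|` = the number of points `y ∈ T₁^{(n)}` with `y ∈ Γ_n(s) ∩ Ω` ((2.2) `gammaRegion s.Ω k′ n`; p. 263 «|Γ_n∩Ω| means the number of points in the set
Γ_n∩Ω ⊂ T₁^{(n)}»). [cite: Balaban1988Convergent, Thm 2 (2.43)–(2.44) p.263, (2.2) p.255, (2.18) p.257] -/
def sect2DataOfRecord₁₃ : B14.Sect2Data where
  K := p.K
  flow := flowOfRun (gOfRecord₁₃ F N θ.toStage13Params p)
  InductiveAssumption := fun k => SLaw₁₃CoPH F N θ p k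
  Ω := Σ k : ℕ, LevelDatum θ p k
  eTerm := fun j k ω => if ω.1 = k then
      EjSubOn (sect2TowerOfRecord F N (FluctV N) p.K (settingOfRecord₁₃ F N θ.toStage13Params p) (θ.rzAt p ω.2.s) ω.2.s ω.2.t)
          (fun j X z => Sect2.admE (F.P p.K) θ.ν θ.τ9.M (gOfRecord₁₃ F N θ.toStage13Params p) ω.2.s.Λ j (Sect2.domSites (F.P p.K) θ.τ9.M j X) z) j
          (fun z => decide (B10Eq38TorusDomains.toFine j z ∈ ω.2.region)) ω.2.U
        - (1 / gOfRecord₁₃ F N θ.toStage13Params p (j - 1) ^ 2 - 1 / gOfRecord₁₃ F N θ.toStage13Params p j ^ 2) * smearedWilson ω.2.weight ω.2.U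
    else 0
  rTerm := fun j k ω => if ω.1 = k then
      RjSubOn (sect2TowerOfRecord F N (FluctV N) p.K (settingOfRecord₁₃ F N θ.toStage13Params p) (θ.rzAt p ω.2.s) ω.2.s ω.2.t) j
        (fun X => decide (Sect2.domSites (F.P p.K) θ.τ9.M j X ⊆ ω.2.s.Λ j ∧ (Sect2.domSites (F.P p.K) θ.τ9.M j X ∩ ω.2.region).Nonempty)) ω.2.U
    else 0
  gammaVol := fun n ω => (Set.ncard {y : Site (F.P p.K) n | B10Eq38TorusDomains.toFine n y ∈ gammaRegion ω.2.s.Ω ω.1 n ∩ ω.2.region} : ℝ)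

/-- `K` of record is the run's number of steps. [cite: Balaban1988Convergent, Thm 1 p.262 (bookkeeping)] -/
theorem sect2DataOfRecord₁₃_K : (sect2DataOfRecord₁₃ θ p).K = p.K := rfl

/-- The flow of record is the run's `flowOfRun`. [cite: Balaban1987RG1, (0.20) p.256 (bookkeeping)] -/
theorem sect2DataOfRecord₁₃_flow : (sect2DataOfRecord₁₃ θ p).flow = flowOfRun (gOfRecord₁₃ F N θ.toStage13Params p) := rfl

/-- The flow of record satisfies (0.20) up to every `K′` (no hypothesis: `flowOfRun_satisfiesRG`). [cite: Balaban1987RG1, (0.20) p.256] -/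
theorem sect2DataOfRecord₁₃_satisfiesRG : (sect2DataOfRecord₁₃ θ p).flow.SatisfiesRG (sect2DataOfRecord₁₃ θ p).K :=
  flowOfRun_satisfiesRG (gOfRecord₁₃ F N θ.toStage13Params p) p.K

/-- Theorem 1's «inductive assumption» of record at level `k` IS `SLaw₁₃CoPH θ p k`. [cite: Balaban1988Convergent, Thm 1 p.262 (bookkeeping)] -/
theorem sect2DataOfRecord₁₃_inductiveAssumption (k : ℕ) : (sect2DataOfRecord₁₃ θ p).InductiveAssumption k = SLaw₁₃CoPH F N θ p k := rfl

open Classical in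
/-- **At level-`k` data the (2.43) left-hand side of record is read without the level guard.** [cite: Balaban1988Convergent, (2.43) p.263 (bookkeeping)] -/
theorem eTerm_mk_self (j k : ℕ) (d : LevelDatum θ p k) :
    (sect2DataOfRecord₁₃ θ p).eTerm j k ⟨k, d⟩ =
      EjSubOn (sect2TowerOfRecord F N (FluctV N) p.K (settingOfRecord₁₃ F N θ.toStage13Params p) (θ.rzAt p d.s) d.s d.t)
          (fun j X z => Sect2.admE (F.P p.K) θ.ν θ.τ9.M (gOfRecord₁₃ F N θ.toStage13Params p) d.s.Λ j (Sect2.domSites (F.P p.K) θ.τ9.M j X) z) j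
          (fun z => decide (B10Eq38TorusDomains.toFine j z ∈ d.region)) d.U
        - (1 / gOfRecord₁₃ F N θ.toStage13Params p (j - 1) ^ 2 - 1 / gOfRecord₁₃ F N θ.toStage13Params p j ^ 2) * smearedWilson d.weight d.U := by
  simp [sect2DataOfRecord₁₃]

/-- Off its own level a datum contributes no (2.43) term. [cite: Balaban1988Convergent, (2.43) p.263 (bookkeeping)] -/
theorem eTerm_mk_of_ne {j k k' : ℕ} (h : k' ≠ k) (d : LevelDatum θ p k') : (sect2DataOfRecord₁₃ θ p).eTerm j k ⟨k', d⟩ = 0 := by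
  simp [sect2DataOfRecord₁₃, h]

open Classical in
/-- **At level-`k` data the (2.44) left-hand side of record is read without the level guard.** [cite: Balaban1988Convergent, (2.44) p.263 (bookkeeping)] -/
theorem rTerm_mk_self (j k : ℕ) (d : LevelDatum θ p k) :
    (sect2DataOfRecord₁₃ θ p).rTerm j k ⟨k, d⟩ =
      RjSubOn (sect2TowerOfRecord F N (FluctV N) p.K (settingOfRecord₁₃ F N θ.toStage13Params p) (θ.rzAt p d.s) d.s d.t) j
        (fun X => decide (Sect2.domSites (F.P p.K) θ.τ9.M j X ⊆ d.s.Λ j ∧ (Sect2.domSites (F.P p.K) θ.τ9.M j X ∩ d.region).Nonempty)) d.U := by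
  simp [sect2DataOfRecord₁₃]

/-- Off its own level a datum contributes no (2.44) term. [cite: Balaban1988Convergent, (2.44) p.263 (bookkeeping)] -/
theorem rTerm_mk_of_ne {j k k' : ℕ} (h : k' ≠ k) (d : LevelDatum θ p k') : (sect2DataOfRecord₁₃ θ p).rTerm j k ⟨k', d⟩ = 0 := by
  simp [sect2DataOfRecord₁₃, h]

/-- The volume `|Γ_n ∩ Ω|` of record, unfolded. [cite: Balaban1988Convergent, (2.2) p.255, p.263 (bookkeeping)] -/
theorem gammaVol_mk (n k : ℕ) (d : LevelDatum θ p k) :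
    (sect2DataOfRecord₁₃ θ p).gammaVol n ⟨k, d⟩ =
      (Set.ncard {y : Site (F.P p.K) n | B10Eq38TorusDomains.toFine n y ∈ gammaRegion d.s.Ω k n ∩ d.region} : ℝ) := rfl

/-- The volumes of record are nonnegative. [cite: Balaban1988Convergent, p.263 (bookkeeping)] -/
theorem gammaVol_nonneg (n : ℕ) (ω : (sect2DataOfRecord₁₃ θ p).Ω) : 0 ≤ (sect2DataOfRecord₁₃ θ p).gammaVol n ω :=
  Nat.cast_nonneg _

open Classical in
/-- **AT `Ω = T_η` AND `φ = φ_j(s)` THE (2.43) LEFT-HAND SIDE OF RECORD IS THIS SEAT's `h243` LEFT-HAND SIDE**: print's «taking Ω = Bʲ(Λ_j⁰), φ = φ_j in (2.43)» at the objects —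
`eTerm j k ⟨k, d⟩ = EjSub(tower of record of (s,t), (2.26)–(2.27) range of s) j U − (g_{j−1}^{−2} − g_j^{−2})·A(φ_j(s), U)` when `d.region = univ` and `d.weight = θ.Phih p k s.Ω s.Λ j`.
[cite: Balaban1988Convergent, (2.43)∕(2.45) p.263, (2.25) p.259] -/
theorem eTerm_at_univ_phi (j k : ℕ) (s : SeqOfRecord F θ.ν θ.τ9.M (gOfRecord₁₃ F N θ.toStage13Params p) p.K k)
    (t : Sect2.TermValues (F.P p.K) (MatA N) (FluctV N) θ.τ9.M) (U : GaugeField (F.P p.K) 0 (SU N)) :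
    (sect2DataOfRecord₁₃ θ p).eTerm j k ⟨k, ⟨s, t, U, Set.univ, θ.Phih p k s.Ω s.Λ j⟩⟩ =
      EjSub (sect2TowerOfRecord F N (FluctV N) p.K (settingOfRecord₁₃ F N θ.toStage13Params p) (θ.rzAt p s) s t)
          (fun j X z => Sect2.admE (F.P p.K) θ.ν θ.τ9.M (gOfRecord₁₃ F N θ.toStage13Params p) s.Λ j (Sect2.domSites (F.P p.K) θ.τ9.M j X) z) j U
        - (1 / gOfRecord₁₃ F N θ.toStage13Params p (j - 1) ^ 2 - 1 / gOfRecord₁₃ F N θ.toStage13Params p j ^ 2) * smearedWilson (θ.Phih p k s.Ω s.Λ j) U := by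
  rw [eTerm_mk_self]
  exact congrArg₂ (· - ·)
    (EjSubOn_of_forall_true (sect2TowerOfRecord F N (FluctV N) p.K (settingOfRecord₁₃ F N θ.toStage13Params p) (θ.rzAt p s) s t)
      (fun j X z => Sect2.admE (F.P p.K) θ.ν θ.τ9.M (gOfRecord₁₃ F N θ.toStage13Params p) s.Λ j (Sect2.domSites (F.P p.K) θ.τ9.M j X) z) j _ U
      (fun z => @decide_eq_true _ (Classical.propDecidable _) (Set.mem_univ _))) rfl

end AtRecord13

end Summit.QuantumFields.YangMills.Theorems.BalabanUVNodesN11Thm2Sect2DataOfRecordDefs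

end
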